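/-
Copyright (c) 2026 the pub-hodgecm-mathlib formalisation cell (harness21).  Prover seat hodgecm-mathlib-K2E3-p23 (g7), HCML Track B «K2-LIT»,
h413 = `stmt-HodgeConjecture-24833`, line `K2_E3_EllipticInputs`, unit U12 «Characters», PART «SC» (ED. 2) leaf (SC-an)₂
`sig_K2E3SupercuspidalTruncatedCharAnalyticTwo`, road «FC₂» (dealer K2E3-plan (g4) D132 «FC₂-8 = THE ASSEMBLY»): §B — (FC)₂ AT THE PLACE, «ELL-WEIGHT»₂ AT THE PLACE,
AND (SC-an)₂ BY `exact` FROM THE ∀-CLOSED `2 × 2` LETTERS AND THE (M5h)₂ ENGINE LETTER.  2026-09-04.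
-/
import Summits.HodgeConjecture.HodgeConjecture.Theorems.K2E3FinConjAssemblyTwo          -- (FC₂-8 §A, this seat): `finConj₂` — (FC) on the model `U(σ, Φ₂)(K)` from the 2 × 2 letters
import Summits.HodgeConjecture.HodgeConjecture.Theorems.K2E3EllWeightPlaceOfFinConjTwo    -- ((FC-9)₂, this seat): `ellWeightPlace_two_of_finConjPlace` — (FC)₂ at the place ⇒ «ELL-WEIGHT»₂ at the place, letter-free
import Literature.NumberTheory.Automorphic.U2JacquetVanishingSupercuspidalOfCartan         -- ★ `UnitaryGroup.exists_coe_eq_diagonal_uniformizer_two` (the ray `d(ϖ, (σϖ)⁻¹) ∈ U(σ, Φ₂)(K)`)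
import HarnessLib

/-!
# h413 ∕ Track B «K2-LIT», unit U12, PART «SC» leaf (SC-an)₂, road «FC₂» — FC₂-8 §B: THE ASSEMBLY AT THE PLACE — (FC)₂ at every non-split place datum `(L, w, μ)`,
# «ELL-WEIGHT»₂ at the place (∀-closed = the antecedent of the (M5h)₂ engine), and **(SC-an)₂ `sig_K2E3SupercuspidalTruncatedCharAnalyticTwo` BY `exact`** from the five
# ∀-closed `2 × 2` letters of ★ `finConj₂` and the ONE engine letter (M5h)₂ «ELL-WEIGHT₂ at the place ⇒ (SC-an)₂»
# (Harish-Chandra 1970 Part VII §3 Thm 16 for `U(1,1)`; the `Fin 2` twin of ★ (FC-10) `K2E3FinConjPlaceOfFinConj` §1–§2 + ★ (M5h‴)'s docking)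

Cell `pub/hodgecm-mathlib`, crux H413 = `stmt-HodgeConjecture-24833`, route of record `HCCMUnconditional`; chair K2-lead (g2), dealer K2E3-plan (g4), architect K2E3-p25 (g3).
THEOREMS ONLY (no `def`, no `instance`, no `notation`, no named-fact hypothesis, no `sorry`); lane `--supports stmt-HodgeConjecture-24833 --as helper`, count-neutral.
HYPOTHESIS-FIRST: the five MODEL LETTERS are ∀-closed over the model frame `K [Field, Valued ℤᵐ⁰, ValuativeRel, Compatible, IsNonarchimedeanLocalField] σ hσ hσv ϖ hϖ J hJ`
(Type-0 `K`, `[CharZero K]` added per the L4 ruling 2026-09-04T14:55:23Z; the only instantiation is `K := L_w`) with EXACTLY the binder texts of ★ `finConj₂` — (F1₂-COVER) `hCOV`, (F1₂-UPPER) `hUP`, (F2₂) `hDIAG`, (FC-6₂) `hCOLL`,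
(FC-5c₂) `hNC` — and the ENGINE LETTER (M5h)₂ `hM5h₂ : ‹ELL-WEIGHT₂ at the place, ∀-closed› → ‹(SC-an)₂›` whose antecedent is ★ (M5h‴)'s `hEW` binder with `Fin 3 ↦ Fin 2`
(`(StdForm.antidiagonal 3) ↦ (StdForm.antidiagonal 2)`, `GL (Fin 3) ↦ GL (Fin 2)`) and whose consequent is PART «SC» ED. 2 :98 `sig_K2E3SupercuspidalTruncatedCharAnalyticTwo` VERBATIM
(the `Fin 2` twin of ★ `K2E3SupercuspidalTruncatedCharAnalyticOfEllWeightPlace` + the D56-type transport to `(cmDatum L 2 Φ₂).Local v` — the XL engine of road «FC₂»).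

* §1 **`finConjPlace_two_of_letters`** — (FC)₂ AT THE PLACE `w ∣ v`: `K := L_w`, `σ := σ_w = galAdicCompletionMap c hw` (`σ_w² = 1` ★, `v ∘ σ_w = v` ★), a uniformiser `ϖ` of `L_w`
  (★ `exists_v_eq_exp_neg_one_adicCompletion`), the ray `a` (★ `exists_coe_eq_diagonal_uniformizer_two`), `J := Φ₂` (`rfl`), the instances `SecondCountableTopology ∕
  LocallyCompactSpace U_w` (★ [M2a] ∕ ★ `K2E3HC14EllU11Haar.locallyCompactSpace_unitary`); then ★ `finConj₂` on the letters at `L_w` — ★ (FC-10) §1 at `2 × 2`.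
* §2 **`ellWeightPlace_two_of_letters`** — «ELL-WEIGHT₂ at the place» ∀-closed (= the (M5h)₂ antecedent TOKEN FOR TOKEN) := ★ (FC-9)₂ `ellWeightPlace_two_of_finConjPlace` ∘ §1.
* §3 **`sigSCanTwo_of_letters (hCOV hUP hDIAG hCOLL hNC) (hM5h₂) : ‹(SC-an)₂ :98 VERBATIM›`** := `hM5h₂ (ellWeightPlace_two_of_letters …)` — THE TIE SHAPE for PART «SC»:
  `sig_K2E3SupercuspidalTruncatedCharAnalyticTwo := K2E3SupercuspidalTruncatedCharAnalyticTwoOfLetters.sigSCanTwo_of_letters ‹five letter sockets∕★ names› ‹(M5h)₂ socket∕★ name›`.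

HONEST LABEL.  HC_CM is proved only modulo the 7 printed citations (2 remaining named inputs: hLiu418 = `stmt-HodgeConjecture-24832`, h413 = `stmt-HodgeConjecture-24833`)
until rung 0 closes; count-neutral; (SC-an)₂ becomes REL over EXACTLY {(F1₂-COVER), (F1₂-UPPER), (F2₂), (FC-6₂), (FC-5c₂), (M5h)₂} when tied — NOT ★; the (M5h)₂ engine is
XL (the `Fin 2` port of the ≈ 95 `Fin 3`-typed files under ★ (M5h‴), K2E3-p27 (g0) sizing 2026-09-04T14:12:25Z).

## References
* [HarishChandra1970] Harish-Chandra (notes by G. van Dijk), *Harmonic Analysis on Reductive p-adic Groups*, LNM 162 (1970), Part V §2 Lemma 14 p. 52; Part VI §8 Thm 14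
  p. 60; Part VII §2 p. 69, §3 Thm 16 p. 67, pp. 70–73.
* [HarishChandra1999] Harish-Chandra (notes by S. DeBacker, P. J. Sally Jr.), *Admissible Invariant Distributions on Reductive p-adic Groups*, AMS ULS 16 (1999), Thm. 16.1 p. 77.
* [Rogawski1990] J. D. Rogawski, *Automorphic Representations of Unitary Groups in Three Variables*, Ann. of Math. Stud. 123 (1990), §1.9–§1.10 pp. 8–9, §12.2 p. 173.
* [BruhatTits1972] F. Bruhat, J. Tits, *Groupes réductifs sur un corps local I*, Publ. Math. IHÉS 41 (1972), (4.4.3).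
-/

set_option autoImplicit false
-- the mandated namespace repeats the single-problem summit's segment (`HodgeConjecture.HodgeConjecture`)
set_option linter.dupNamespace false

noncomputable section

open MeasureTheory Measure Set Filter Topology NumberField IsDedekindDomain
open scoped NNReal ENNReal Pointwise Matrix MatrixGroups WithZero Valued
open ValuativeRel
open Literature.NumberTheory.Automorphic Literature.NumberTheory.Automorphic.UnitaryGroup Literature.NumberTheory.Automorphic.HermitianLattice Literature.NumberTheory.Rogawski1990
open Literature.NumberTheory.GaloisRepresentations Literature.NumberTheory.GaloisRepresentations.IsNonarchimedeanLocalField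

namespace Summit.HodgeConjecture.HodgeConjecture.Cruxes.H413.K2E3SupercuspidalTruncatedCharAnalyticTwoOfLetters

/-! ## §1 (FC)₂ at the place `w ∣ v`, from the ∀-closed model letters -/

set_option maxHeartbeats 1600000 in -- long statement: five ∀-closed letters + the one-place carrier
/-- **(FC)₂ AT THE PLACE `w ∣ v`, FROM THE ∀-CLOSED `2 × 2` LETTERS** — for `U_w := U(σ_w, Φ₂)(L_w)` and any Haar `μ`: `∀ C ⊆ U_w` compact, `∀ β ∈ C_c(U_w, [0, Mb])` (`Mb < ⊤`):
`∫⁻_{C ∩ Φ_β} ∫⁻ β(x g x⁻¹) dx dg < ⊤`, `Φ_β = {g | ∫⁻ β(xgx⁻¹) dx < ⊤}` — ★ `finConj₂` at `K := L_w`, `σ := σ_w`, a uniformiser `ϖ`, the ray `a = d(ϖ, (σ_wϖ)⁻¹)` (★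
`exists_coe_eq_diagonal_uniformizer_two`), `J := Φ₂`, fed with the letters instantiated at `L_w`; the ★ (FC-10) §1 recipe at `2 × 2`.  The five letters are the binders of ★
`finConj₂` ∀-closed over the model frame (Type-0 `K`). [cite: HarishChandra1970, Part V §2 Lemma 14 p. 52; Part VI §8 Thm 14 p. 60; Part VII §2 p. 69]
[cite: Rogawski1990, §1.10 p. 9] [cite: BruhatTits1972, (4.4.3)] -/
theorem finConjPlace_two_of_letters
    (hCOV : ∀ (K : Type) [Field K] [Valued K ℤᵐ⁰] [ValuativeRel K] [(Valued.v : Valuation K ℤᵐ⁰).Compatible] [IsNonarchimedeanLocalField K] [CharZero K]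
      (σ : K →+* K), (∀ x, σ (σ x) = x) → (∀ x, Valued.v (σ x) = Valued.v x) → ∀ {ϖ : K}, Valued.v ϖ = WithZero.exp (-1 : ℤ) →
      ∀ {J : Matrix (Fin 2) (Fin 2) K}, J = (StdForm.antidiagonal 2).over K →
      ∀ (a : ↥(unitaryGroupOfForm σ J)), ((a : GL (Fin 2) K) : Matrix (Fin 2) (Fin 2) K) = Matrix.diagonal ![ϖ, (σ ϖ)⁻¹] →
      ∀ g : ↥(unitaryGroupOfForm σ J), ∃ n : ℕ, g ∈ (unitaryInt σ J : Set ↥(unitaryGroupOfForm σ J)) * {(a ^ n)⁻¹} * (unitaryInt σ J : Set ↥(unitaryGroupOfForm σ J)))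
    (hUP : ∀ (K : Type) [Field K] [Valued K ℤᵐ⁰] [ValuativeRel K] [(Valued.v : Valuation K ℤᵐ⁰).Compatible] [IsNonarchimedeanLocalField K] [CharZero K]
      (σ : K →+* K), (∀ x, σ (σ x) = x) → (∀ x, Valued.v (σ x) = Valued.v x) → ∀ {ϖ : K}, Valued.v ϖ = WithZero.exp (-1 : ℤ) →
      ∀ {J : Matrix (Fin 2) (Fin 2) K}, J = (StdForm.antidiagonal 2).over K →
      ∀ (a : ↥(unitaryGroupOfForm σ J)), ((a : GL (Fin 2) K) : Matrix (Fin 2) (Fin 2) K) = Matrix.diagonal ![ϖ, (σ ϖ)⁻¹] →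
      ∀ (n M : ℕ) (h : ↥(unitaryGroupOfForm σ J)),
        (∀ i j, Valued.v (((((a ^ n)⁻¹ * h * a ^ n : ↥(unitaryGroupOfForm σ J)) : GL (Fin 2) K) : Matrix (Fin 2) (Fin 2) K) i j) ≤ WithZero.exp (M : ℤ)) →
          Valued.v (((h : GL (Fin 2) K) : Matrix (Fin 2) (Fin 2) K) 0 1) ≤ WithZero.exp ((M : ℤ) - 2 * n))
    (hDIAG : ∀ (K : Type) [Field K] [Valued K ℤᵐ⁰] [ValuativeRel K] [(Valued.v : Valuation K ℤᵐ⁰).Compatible] [IsNonarchimedeanLocalField K] [CharZero K]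
      (σ : K →+* K), (∀ x, σ (σ x) = x) → (∀ x, Valued.v (σ x) = Valued.v x) → ∀ {ϖ : K}, Valued.v ϖ = WithZero.exp (-1 : ℤ) →
      ∀ {J : Matrix (Fin 2) (Fin 2) K}, J = (StdForm.antidiagonal 2).over K →
      ∀ (M n : ℕ), 3 * M < n → ∀ h : ↥(unitaryGroupOfForm σ J),
        (∀ i j, Valued.v (((h : GL (Fin 2) K) : Matrix (Fin 2) (Fin 2) K) i j) ≤ WithZero.exp (M : ℤ)) →
        Valued.v (((h : GL (Fin 2) K) : Matrix (Fin 2) (Fin 2) K) 0 1) ≤ WithZero.exp ((M : ℤ) - 2 * n) →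
          ∀ i, WithZero.exp (-(2 * (M : ℤ))) ≤ Valued.v (((h : GL (Fin 2) K) : Matrix (Fin 2) (Fin 2) K) i i))
    (hCOLL : ∀ (K : Type) [Field K] [Valued K ℤᵐ⁰] [ValuativeRel K] [(Valued.v : Valuation K ℤᵐ⁰).Compatible] [IsNonarchimedeanLocalField K] [CharZero K]
      (σ : K →+* K), (∀ x, σ (σ x) = x) → (∀ x, Valued.v (σ x) = Valued.v x) → ∀ {ϖ : K}, Valued.v ϖ = WithZero.exp (-1 : ℤ) →
      ∀ {J : Matrix (Fin 2) (Fin 2) K}, J = (StdForm.antidiagonal 2).over K →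
      ∀ (M k d : ℕ), 5 * M + 4 * k + 2 ≤ d → ∀ g : ↥(unitaryGroupOfForm σ J),
        (∀ i j, Valued.v (((g : GL (Fin 2) K) : Matrix (Fin 2) (Fin 2) K) i j) ≤ WithZero.exp (M : ℤ)) →
        Valued.v (((g : GL (Fin 2) K) : Matrix (Fin 2) (Fin 2) K) 0 1) ≤ WithZero.exp ((M : ℤ) - 2 * d) →
        IsCompact ((Subgroup.centralizer ({g} : Set ↥(unitaryGroupOfForm σ J))) : Set ↥(unitaryGroupOfForm σ J)) →
          ∃ i j : Fin 2, i ≠ j ∧ Valued.v (((g : GL (Fin 2) K) : Matrix (Fin 2) (Fin 2) K) i i - ((g : GL (Fin 2) K) : Matrix (Fin 2) (Fin 2) K) j j) < WithZero.exp (-(k : ℤ)))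
    (hNC : ∀ (K : Type) [Field K] [Valued K ℤᵐ⁰] [ValuativeRel K] [(Valued.v : Valuation K ℤᵐ⁰).Compatible] [IsNonarchimedeanLocalField K] [CharZero K]
      (σ : K →+* K), (∀ x, σ (σ x) = x) → (∀ x, Valued.v (σ x) = Valued.v x) → ∀ {ϖ : K}, Valued.v ϖ = WithZero.exp (-1 : ℤ) →
      ∀ {J : Matrix (Fin 2) (Fin 2) K}, J = (StdForm.antidiagonal 2).over K →
      ∀ [MeasurableSpace ↥(unitaryGroupOfForm σ J)] [BorelSpace ↥(unitaryGroupOfForm σ J)] [SecondCountableTopology ↥(unitaryGroupOfForm σ J)] [LocallyCompactSpace ↥(unitaryGroupOfForm σ J)]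
        (μ : Measure ↥(unitaryGroupOfForm σ J)) [μ.IsHaarMeasure],
      ∃ κ : ℝ, 0 < κ ∧ ∃ C : ℝ≥0∞, C ≠ ⊤ ∧ ∀ ρ : ℝ≥0, 0 < ρ → ∀ ε : ℝ≥0,
        ∀ B : Set ↥(unitaryGroupOfForm σ J), MeasurableSet B →
          (∀ t : ↥(unitaryGroupOfForm σ J),
            (∃ a' : Kˣ, valuation K (a' : K) = 1 ∧ (t : GL (Fin 2) K) = glDiagonal 2 K ![a', (Units.map (σ : K →* K) a')⁻¹]) → t • B = B) →
          (∀ g ∈ B, ρ ≤ normAbs K (((g : GL (Fin 2) K) : Matrix (Fin 2) (Fin 2) K) 0 0) ∧ ρ ≤ normAbs K (((g : GL (Fin 2) K) : Matrix (Fin 2) (Fin 2) K) 1 1)) →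
          μ (B ∩ {g | ∃ i j : Fin 2, i ≠ j ∧ normAbs K (((g : GL (Fin 2) K) : Matrix (Fin 2) (Fin 2) K) i i - ((g : GL (Fin 2) K) : Matrix (Fin 2) (Fin 2) K) j j) ≤ ε}) ≤
            C * ((ε / ρ : ℝ≥0) : ℝ≥0∞) ^ κ * μ B) :
    ∀ (L' : Type) [Field L'] [NumberField L'] [IsCMField L'] {v' : HeightOneSpectrum (𝓞 ↥(maximalRealSubfield L'))}
      (w' : UnitaryGroup.PlacesOver L' v') (hw' : IsCMField.complexConj L' • w'.1 = w'.1)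
      [MeasurableSpace ↥(unitaryGroupOfForm (galAdicCompletionMap (L := L') (IsCMField.complexConj L') hw') ((StdForm.antidiagonal 2).over (w'.1.adicCompletion L')))]
      [BorelSpace ↥(unitaryGroupOfForm (galAdicCompletionMap (L := L') (IsCMField.complexConj L') hw') ((StdForm.antidiagonal 2).over (w'.1.adicCompletion L')))]
      (μ' : Measure ↥(unitaryGroupOfForm (galAdicCompletionMap (L := L') (IsCMField.complexConj L') hw') ((StdForm.antidiagonal 2).over (w'.1.adicCompletion L')))) [μ'.IsHaarMeasure],
      ∀ {C : Set ↥(unitaryGroupOfForm (galAdicCompletionMap (L := L') (IsCMField.complexConj L') hw') ((StdForm.antidiagonal 2).over (w'.1.adicCompletion L')))}, IsCompact C →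
        ∀ {β : ↥(unitaryGroupOfForm (galAdicCompletionMap (L := L') (IsCMField.complexConj L') hw') ((StdForm.antidiagonal 2).over (w'.1.adicCompletion L'))) → ℝ≥0∞},
          Continuous β → IsCompact (tsupport β) → ∀ {Mb : ℝ≥0∞}, Mb ≠ ⊤ → (∀ g, β g ≤ Mb) →
            ∫⁻ g in C ∩ {g | ∫⁻ x, β (x * g * x⁻¹) ∂μ' < ⊤}, ∫⁻ x, β (x * g * x⁻¹) ∂μ' ∂μ' < ⊤ := by
  intro L' _ _ _ v' w' hw' _ _ μ' _ C hC β hβ hβs Mb hMb hβM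
  haveI : CharZero (w'.1.adicCompletion L') := charZero_of_injective_algebraMap (algebraMap L' (w'.1.adicCompletion L')).injective
  haveI : SecondCountableTopology ↥(unitaryGroupOfForm (galAdicCompletionMap (L := L') (IsCMField.complexConj L') hw') ((StdForm.antidiagonal 2).over (w'.1.adicCompletion L'))) :=
    K2E3SupercuspModelFrameAtPlace.secondCountableTopology_unitaryGroupOfForm_adicCompletion L' w' _ _
  haveI : LocallyCompactSpace ↥(unitaryGroupOfForm (galAdicCompletionMap (L := L') (IsCMField.complexConj L') hw') ((StdForm.antidiagonal 2).over (w'.1.adicCompletion L'))) :=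
    K2E3HC14EllU11Haar.locallyCompactSpace_unitary (continuous_galAdicCompletionMap L' (IsCMField.complexConj L') hw') _
  have hσσ : ∀ x, galAdicCompletionMap (L := L') (IsCMField.complexConj L') hw' (galAdicCompletionMap (L := L') (IsCMField.complexConj L') hw' x) = x :=
    galAdicCompletionMap_galAdicCompletionMap_of_smul_eq (IsCMField.complexConj L') w' (IsCMField.complexConj_ne_one L') hw'
  have hσv : ∀ x, Valued.v (galAdicCompletionMap (L := L') (IsCMField.complexConj L') hw' x) = Valued.v x :=
    fun x => valued_galAdicCompletionMap (L := L') (IsCMField.complexConj L') hw' x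
  obtain ⟨ϖ, hϖ⟩ := exists_v_eq_exp_neg_one_adicCompletion (E := L') w'.1
  have hϖ0 : ϖ ≠ 0 := fun h => by rw [h, map_zero] at hϖ; exact WithZero.zero_ne_coe hϖ
  obtain ⟨a, ha⟩ := UnitaryGroup.exists_coe_eq_diagonal_uniformizer_two (galAdicCompletionMap (L := L') (IsCMField.complexConj L') hw')
    (J := (StdForm.antidiagonal 2).over (w'.1.adicCompletion L')) rfl hσσ hϖ0
  exact K2E3FinConjAssemblyTwo.finConj₂ (galAdicCompletionMap (L := L') (IsCMField.complexConj L') hw') hσσ hσv hϖ rfl μ' a ha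
    (hCOV _ _ hσσ hσv hϖ rfl a ha) (hUP _ _ hσσ hσv hϖ rfl a ha) (hDIAG _ _ hσσ hσv hϖ rfl) (hCOLL _ _ hσσ hσv hϖ rfl)
    (hNC _ _ hσσ hσv hϖ rfl μ') hC hβ hβs hMb hβM

/-! ## §2 «ELL-WEIGHT»₂ at the place, ∀-closed — the (M5h)₂ antecedent -/

set_option maxHeartbeats 1600000 in -- long statement: five ∀-closed letters + the ∀-closed weight statement
/-- **«ELL-WEIGHT₂ AT THE PLACE», ∀-CLOSED, FROM THE LETTERS** — for every `(L, w ∣ v, μ)` and every compact `S ⊆ U_w` there is `W_E : U_w → ℝ`, `0 ≤ W_E ∈ L¹_loc(μ)`, with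
`∫⁻ x, Θ (x γ x⁻¹) ∂μ ≤ W_E(γ) · Mb` for every regular `γ` with compact centraliser and every Borel `Θ ≤ Mb` vanishing off `S`: ★ (FC-9)₂ `ellWeightPlace_two_of_finConjPlace` fed
with §1.  The statement is ★ (M5h‴)'s binder `hEW` with `Fin 3 ↦ Fin 2` TOKEN FOR TOKEN — the antecedent currency of the (M5h)₂ engine letter.
[cite: HarishChandra1970, Part V §2 Lemma 14 p. 52; Part VII §3 pp. 70–73] [cite: Rogawski1990, §12.2 p. 173] -/
theorem ellWeightPlace_two_of_letters
    (hCOV : ∀ (K : Type) [Field K] [Valued K ℤᵐ⁰] [ValuativeRel K] [(Valued.v : Valuation K ℤᵐ⁰).Compatible] [IsNonarchimedeanLocalField K] [CharZero K]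
      (σ : K →+* K), (∀ x, σ (σ x) = x) → (∀ x, Valued.v (σ x) = Valued.v x) → ∀ {ϖ : K}, Valued.v ϖ = WithZero.exp (-1 : ℤ) →
      ∀ {J : Matrix (Fin 2) (Fin 2) K}, J = (StdForm.antidiagonal 2).over K →
      ∀ (a : ↥(unitaryGroupOfForm σ J)), ((a : GL (Fin 2) K) : Matrix (Fin 2) (Fin 2) K) = Matrix.diagonal ![ϖ, (σ ϖ)⁻¹] →
      ∀ g : ↥(unitaryGroupOfForm σ J), ∃ n : ℕ, g ∈ (unitaryInt σ J : Set ↥(unitaryGroupOfForm σ J)) * {(a ^ n)⁻¹} * (unitaryInt σ J : Set ↥(unitaryGroupOfForm σ J)))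
    (hUP : ∀ (K : Type) [Field K] [Valued K ℤᵐ⁰] [ValuativeRel K] [(Valued.v : Valuation K ℤᵐ⁰).Compatible] [IsNonarchimedeanLocalField K] [CharZero K]
      (σ : K →+* K), (∀ x, σ (σ x) = x) → (∀ x, Valued.v (σ x) = Valued.v x) → ∀ {ϖ : K}, Valued.v ϖ = WithZero.exp (-1 : ℤ) →
      ∀ {J : Matrix (Fin 2) (Fin 2) K}, J = (StdForm.antidiagonal 2).over K →
      ∀ (a : ↥(unitaryGroupOfForm σ J)), ((a : GL (Fin 2) K) : Matrix (Fin 2) (Fin 2) K) = Matrix.diagonal ![ϖ, (σ ϖ)⁻¹] →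
      ∀ (n M : ℕ) (h : ↥(unitaryGroupOfForm σ J)),
        (∀ i j, Valued.v (((((a ^ n)⁻¹ * h * a ^ n : ↥(unitaryGroupOfForm σ J)) : GL (Fin 2) K) : Matrix (Fin 2) (Fin 2) K) i j) ≤ WithZero.exp (M : ℤ)) →
          Valued.v (((h : GL (Fin 2) K) : Matrix (Fin 2) (Fin 2) K) 0 1) ≤ WithZero.exp ((M : ℤ) - 2 * n))
    (hDIAG : ∀ (K : Type) [Field K] [Valued K ℤᵐ⁰] [ValuativeRel K] [(Valued.v : Valuation K ℤᵐ⁰).Compatible] [IsNonarchimedeanLocalField K] [CharZero K]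
      (σ : K →+* K), (∀ x, σ (σ x) = x) → (∀ x, Valued.v (σ x) = Valued.v x) → ∀ {ϖ : K}, Valued.v ϖ = WithZero.exp (-1 : ℤ) →
      ∀ {J : Matrix (Fin 2) (Fin 2) K}, J = (StdForm.antidiagonal 2).over K →
      ∀ (M n : ℕ), 3 * M < n → ∀ h : ↥(unitaryGroupOfForm σ J),
        (∀ i j, Valued.v (((h : GL (Fin 2) K) : Matrix (Fin 2) (Fin 2) K) i j) ≤ WithZero.exp (M : ℤ)) →
        Valued.v (((h : GL (Fin 2) K) : Matrix (Fin 2) (Fin 2) K) 0 1) ≤ WithZero.exp ((M : ℤ) - 2 * n) →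
          ∀ i, WithZero.exp (-(2 * (M : ℤ))) ≤ Valued.v (((h : GL (Fin 2) K) : Matrix (Fin 2) (Fin 2) K) i i))
    (hCOLL : ∀ (K : Type) [Field K] [Valued K ℤᵐ⁰] [ValuativeRel K] [(Valued.v : Valuation K ℤᵐ⁰).Compatible] [IsNonarchimedeanLocalField K] [CharZero K]
      (σ : K →+* K), (∀ x, σ (σ x) = x) → (∀ x, Valued.v (σ x) = Valued.v x) → ∀ {ϖ : K}, Valued.v ϖ = WithZero.exp (-1 : ℤ) →
      ∀ {J : Matrix (Fin 2) (Fin 2) K}, J = (StdForm.antidiagonal 2).over K →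
      ∀ (M k d : ℕ), 5 * M + 4 * k + 2 ≤ d → ∀ g : ↥(unitaryGroupOfForm σ J),
        (∀ i j, Valued.v (((g : GL (Fin 2) K) : Matrix (Fin 2) (Fin 2) K) i j) ≤ WithZero.exp (M : ℤ)) →
        Valued.v (((g : GL (Fin 2) K) : Matrix (Fin 2) (Fin 2) K) 0 1) ≤ WithZero.exp ((M : ℤ) - 2 * d) →
        IsCompact ((Subgroup.centralizer ({g} : Set ↥(unitaryGroupOfForm σ J))) : Set ↥(unitaryGroupOfForm σ J)) →
          ∃ i j : Fin 2, i ≠ j ∧ Valued.v (((g : GL (Fin 2) K) : Matrix (Fin 2) (Fin 2) K) i i - ((g : GL (Fin 2) K) : Matrix (Fin 2) (Fin 2) K) j j) < WithZero.exp (-(k : ℤ)))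
    (hNC : ∀ (K : Type) [Field K] [Valued K ℤᵐ⁰] [ValuativeRel K] [(Valued.v : Valuation K ℤᵐ⁰).Compatible] [IsNonarchimedeanLocalField K] [CharZero K]
      (σ : K →+* K), (∀ x, σ (σ x) = x) → (∀ x, Valued.v (σ x) = Valued.v x) → ∀ {ϖ : K}, Valued.v ϖ = WithZero.exp (-1 : ℤ) →
      ∀ {J : Matrix (Fin 2) (Fin 2) K}, J = (StdForm.antidiagonal 2).over K →
      ∀ [MeasurableSpace ↥(unitaryGroupOfForm σ J)] [BorelSpace ↥(unitaryGroupOfForm σ J)] [SecondCountableTopology ↥(unitaryGroupOfForm σ J)] [LocallyCompactSpace ↥(unitaryGroupOfForm σ J)]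
        (μ : Measure ↥(unitaryGroupOfForm σ J)) [μ.IsHaarMeasure],
      ∃ κ : ℝ, 0 < κ ∧ ∃ C : ℝ≥0∞, C ≠ ⊤ ∧ ∀ ρ : ℝ≥0, 0 < ρ → ∀ ε : ℝ≥0,
        ∀ B : Set ↥(unitaryGroupOfForm σ J), MeasurableSet B →
          (∀ t : ↥(unitaryGroupOfForm σ J),
            (∃ a' : Kˣ, valuation K (a' : K) = 1 ∧ (t : GL (Fin 2) K) = glDiagonal 2 K ![a', (Units.map (σ : K →* K) a')⁻¹]) → t • B = B) →
          (∀ g ∈ B, ρ ≤ normAbs K (((g : GL (Fin 2) K) : Matrix (Fin 2) (Fin 2) K) 0 0) ∧ ρ ≤ normAbs K (((g : GL (Fin 2) K) : Matrix (Fin 2) (Fin 2) K) 1 1)) →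
          μ (B ∩ {g | ∃ i j : Fin 2, i ≠ j ∧ normAbs K (((g : GL (Fin 2) K) : Matrix (Fin 2) (Fin 2) K) i i - ((g : GL (Fin 2) K) : Matrix (Fin 2) (Fin 2) K) j j) ≤ ε}) ≤
            C * ((ε / ρ : ℝ≥0) : ℝ≥0∞) ^ κ * μ B) :
    ∀ (L' : Type) [Field L'] [NumberField L'] [IsCMField L'] {v' : HeightOneSpectrum (𝓞 ↥(maximalRealSubfield L'))}
      (w' : UnitaryGroup.PlacesOver L' v') (hw' : IsCMField.complexConj L' • w'.1 = w'.1)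
      [MeasurableSpace ↥(unitaryGroupOfForm (galAdicCompletionMap (L := L') (IsCMField.complexConj L') hw') ((StdForm.antidiagonal 2).over (w'.1.adicCompletion L')))]
      [BorelSpace ↥(unitaryGroupOfForm (galAdicCompletionMap (L := L') (IsCMField.complexConj L') hw') ((StdForm.antidiagonal 2).over (w'.1.adicCompletion L')))]
      (μ' : Measure ↥(unitaryGroupOfForm (galAdicCompletionMap (L := L') (IsCMField.complexConj L') hw') ((StdForm.antidiagonal 2).over (w'.1.adicCompletion L')))) [μ'.IsHaarMeasure]
      {S : Set ↥(unitaryGroupOfForm (galAdicCompletionMap (L := L') (IsCMField.complexConj L') hw') ((StdForm.antidiagonal 2).over (w'.1.adicCompletion L')))} (_ : IsCompact S),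
      ∃ W_E : ↥(unitaryGroupOfForm (galAdicCompletionMap (L := L') (IsCMField.complexConj L') hw') ((StdForm.antidiagonal 2).over (w'.1.adicCompletion L'))) → ℝ,
        LocallyIntegrable W_E μ' ∧ (∀ g, 0 ≤ W_E g) ∧
        ∀ γ : ↥(unitaryGroupOfForm (galAdicCompletionMap (L := L') (IsCMField.complexConj L') hw') ((StdForm.antidiagonal 2).over (w'.1.adicCompletion L'))),
          IsRegularElt (γ : GL (Fin 2) (w'.1.adicCompletion L')) →
          IsCompact ((Subgroup.centralizer ({γ} : Set ↥(unitaryGroupOfForm (galAdicCompletionMap (L := L') (IsCMField.complexConj L') hw') ((StdForm.antidiagonal 2).over (w'.1.adicCompletion L'))))) :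
              Set ↥(unitaryGroupOfForm (galAdicCompletionMap (L := L') (IsCMField.complexConj L') hw') ((StdForm.antidiagonal 2).over (w'.1.adicCompletion L')))) →
            ∀ Θ : ↥(unitaryGroupOfForm (galAdicCompletionMap (L := L') (IsCMField.complexConj L') hw') ((StdForm.antidiagonal 2).over (w'.1.adicCompletion L'))) → ℝ≥0∞,
              Measurable Θ → (∀ g, Θ g ≠ 0 → g ∈ S) → ∀ Mb : ℝ≥0∞, (∀ g, Θ g ≤ Mb) →
                ∫⁻ x, Θ (x * γ * x⁻¹) ∂μ' ≤ ENNReal.ofReal (W_E γ) * Mb :=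
  fun L' _ _ _ _ w' hw' _ _ μ' _ _ hS =>
    K2E3EllWeightPlaceOfFinConjTwo.ellWeightPlace_two_of_finConjPlace (finConjPlace_two_of_letters hCOV hUP hDIAG hCOLL hNC) L' w' hw' μ' hS

/-! ## §3 (SC-an)₂ BY `exact` from the letters and the (M5h)₂ engine -/

set_option maxHeartbeats 1600000 in -- long statement: the letters, the engine letter and the (SC-an)₂ socket text
set_option synthInstance.maxHeartbeats 400000 in
open scoped Classical in
/-- **THE ASSEMBLY OF ROAD «FC₂»: (SC-an)₂ `sig_K2E3SupercuspidalTruncatedCharAnalyticTwo` (PART «SC» ED. 2 :98 VERBATIM) FROM THE FIVE `2 × 2` MODEL LETTERS AND THE (M5h)₂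
ENGINE LETTER** — Harish-Chandra's two estimates ((SC-lim∖ell) a.e. convergence off the regular-elliptic set and (SC-dom) locally integrable domination) on the truncated orbital
integrals of a supercuspidal coefficient of `U(Φ₂)(L⁺_v)`, `v` non-split, hold GIVEN (F1₂-COVER), (F1₂-UPPER), (F2₂), (FC-6₂), (FC-5c₂) (whence (FC)₂ and «ELL-WEIGHT₂ at the
place» by §§1–2, letter-free otherwise) and the engine (M5h)₂ «ELL-WEIGHT₂ at the place ⇒ (SC-an)₂» (the `Fin 2` port of ★ (M5h‴) + the transport to `(cmDatum L 2 Φ₂).Local v`;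
XL, open).  Proof: `hM5h₂` applied to §2.  TIE SHAPE for the dealer: `sig_K2E3SupercuspidalTruncatedCharAnalyticTwo := sigSCanTwo_of_letters ‹letters› ‹(M5h)₂›`.
[cite: HarishChandra1970, Part VII §3 Thm. 16 p. 67, pp. 70–73; Thms 14–15, 18–20] [cite: HarishChandra1999, Thm. 16.1 p. 77] [cite: Rogawski1990, §12.2 p. 173] -/
theorem sigSCanTwo_of_letters
    (hCOV : ∀ (K : Type) [Field K] [Valued K ℤᵐ⁰] [ValuativeRel K] [(Valued.v : Valuation K ℤᵐ⁰).Compatible] [IsNonarchimedeanLocalField K] [CharZero K]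
      (σ : K →+* K), (∀ x, σ (σ x) = x) → (∀ x, Valued.v (σ x) = Valued.v x) → ∀ {ϖ : K}, Valued.v ϖ = WithZero.exp (-1 : ℤ) →
      ∀ {J : Matrix (Fin 2) (Fin 2) K}, J = (StdForm.antidiagonal 2).over K →
      ∀ (a : ↥(unitaryGroupOfForm σ J)), ((a : GL (Fin 2) K) : Matrix (Fin 2) (Fin 2) K) = Matrix.diagonal ![ϖ, (σ ϖ)⁻¹] →
      ∀ g : ↥(unitaryGroupOfForm σ J), ∃ n : ℕ, g ∈ (unitaryInt σ J : Set ↥(unitaryGroupOfForm σ J)) * {(a ^ n)⁻¹} * (unitaryInt σ J : Set ↥(unitaryGroupOfForm σ J)))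
    (hUP : ∀ (K : Type) [Field K] [Valued K ℤᵐ⁰] [ValuativeRel K] [(Valued.v : Valuation K ℤᵐ⁰).Compatible] [IsNonarchimedeanLocalField K] [CharZero K]
      (σ : K →+* K), (∀ x, σ (σ x) = x) → (∀ x, Valued.v (σ x) = Valued.v x) → ∀ {ϖ : K}, Valued.v ϖ = WithZero.exp (-1 : ℤ) →
      ∀ {J : Matrix (Fin 2) (Fin 2) K}, J = (StdForm.antidiagonal 2).over K →
      ∀ (a : ↥(unitaryGroupOfForm σ J)), ((a : GL (Fin 2) K) : Matrix (Fin 2) (Fin 2) K) = Matrix.diagonal ![ϖ, (σ ϖ)⁻¹] →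
      ∀ (n M : ℕ) (h : ↥(unitaryGroupOfForm σ J)),
        (∀ i j, Valued.v (((((a ^ n)⁻¹ * h * a ^ n : ↥(unitaryGroupOfForm σ J)) : GL (Fin 2) K) : Matrix (Fin 2) (Fin 2) K) i j) ≤ WithZero.exp (M : ℤ)) →
          Valued.v (((h : GL (Fin 2) K) : Matrix (Fin 2) (Fin 2) K) 0 1) ≤ WithZero.exp ((M : ℤ) - 2 * n))
    (hDIAG : ∀ (K : Type) [Field K] [Valued K ℤᵐ⁰] [ValuativeRel K] [(Valued.v : Valuation K ℤᵐ⁰).Compatible] [IsNonarchimedeanLocalField K] [CharZero K]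
      (σ : K →+* K), (∀ x, σ (σ x) = x) → (∀ x, Valued.v (σ x) = Valued.v x) → ∀ {ϖ : K}, Valued.v ϖ = WithZero.exp (-1 : ℤ) →
      ∀ {J : Matrix (Fin 2) (Fin 2) K}, J = (StdForm.antidiagonal 2).over K →
      ∀ (M n : ℕ), 3 * M < n → ∀ h : ↥(unitaryGroupOfForm σ J),
        (∀ i j, Valued.v (((h : GL (Fin 2) K) : Matrix (Fin 2) (Fin 2) K) i j) ≤ WithZero.exp (M : ℤ)) →
        Valued.v (((h : GL (Fin 2) K) : Matrix (Fin 2) (Fin 2) K) 0 1) ≤ WithZero.exp ((M : ℤ) - 2 * n) →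
          ∀ i, WithZero.exp (-(2 * (M : ℤ))) ≤ Valued.v (((h : GL (Fin 2) K) : Matrix (Fin 2) (Fin 2) K) i i))
    (hCOLL : ∀ (K : Type) [Field K] [Valued K ℤᵐ⁰] [ValuativeRel K] [(Valued.v : Valuation K ℤᵐ⁰).Compatible] [IsNonarchimedeanLocalField K] [CharZero K]
      (σ : K →+* K), (∀ x, σ (σ x) = x) → (∀ x, Valued.v (σ x) = Valued.v x) → ∀ {ϖ : K}, Valued.v ϖ = WithZero.exp (-1 : ℤ) →
      ∀ {J : Matrix (Fin 2) (Fin 2) K}, J = (StdForm.antidiagonal 2).over K →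
      ∀ (M k d : ℕ), 5 * M + 4 * k + 2 ≤ d → ∀ g : ↥(unitaryGroupOfForm σ J),
        (∀ i j, Valued.v (((g : GL (Fin 2) K) : Matrix (Fin 2) (Fin 2) K) i j) ≤ WithZero.exp (M : ℤ)) →
        Valued.v (((g : GL (Fin 2) K) : Matrix (Fin 2) (Fin 2) K) 0 1) ≤ WithZero.exp ((M : ℤ) - 2 * d) →
        IsCompact ((Subgroup.centralizer ({g} : Set ↥(unitaryGroupOfForm σ J))) : Set ↥(unitaryGroupOfForm σ J)) →
          ∃ i j : Fin 2, i ≠ j ∧ Valued.v (((g : GL (Fin 2) K) : Matrix (Fin 2) (Fin 2) K) i i - ((g : GL (Fin 2) K) : Matrix (Fin 2) (Fin 2) K) j j) < WithZero.exp (-(k : ℤ)))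
    (hNC : ∀ (K : Type) [Field K] [Valued K ℤᵐ⁰] [ValuativeRel K] [(Valued.v : Valuation K ℤᵐ⁰).Compatible] [IsNonarchimedeanLocalField K] [CharZero K]
      (σ : K →+* K), (∀ x, σ (σ x) = x) → (∀ x, Valued.v (σ x) = Valued.v x) → ∀ {ϖ : K}, Valued.v ϖ = WithZero.exp (-1 : ℤ) →
      ∀ {J : Matrix (Fin 2) (Fin 2) K}, J = (StdForm.antidiagonal 2).over K →
      ∀ [MeasurableSpace ↥(unitaryGroupOfForm σ J)] [BorelSpace ↥(unitaryGroupOfForm σ J)] [SecondCountableTopology ↥(unitaryGroupOfForm σ J)] [LocallyCompactSpace ↥(unitaryGroupOfForm σ J)]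
        (μ : Measure ↥(unitaryGroupOfForm σ J)) [μ.IsHaarMeasure],
      ∃ κ : ℝ, 0 < κ ∧ ∃ C : ℝ≥0∞, C ≠ ⊤ ∧ ∀ ρ : ℝ≥0, 0 < ρ → ∀ ε : ℝ≥0,
        ∀ B : Set ↥(unitaryGroupOfForm σ J), MeasurableSet B →
          (∀ t : ↥(unitaryGroupOfForm σ J),
            (∃ a' : Kˣ, valuation K (a' : K) = 1 ∧ (t : GL (Fin 2) K) = glDiagonal 2 K ![a', (Units.map (σ : K →* K) a')⁻¹]) → t • B = B) →
          (∀ g ∈ B, ρ ≤ normAbs K (((g : GL (Fin 2) K) : Matrix (Fin 2) (Fin 2) K) 0 0) ∧ ρ ≤ normAbs K (((g : GL (Fin 2) K) : Matrix (Fin 2) (Fin 2) K) 1 1)) →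
          μ (B ∩ {g | ∃ i j : Fin 2, i ≠ j ∧ normAbs K (((g : GL (Fin 2) K) : Matrix (Fin 2) (Fin 2) K) i i - ((g : GL (Fin 2) K) : Matrix (Fin 2) (Fin 2) K) j j) ≤ ε}) ≤
            C * ((ε / ρ : ℝ≥0) : ℝ≥0∞) ^ κ * μ B)
    (hM5h₂ : (∀ (L' : Type) [Field L'] [NumberField L'] [IsCMField L'] {v' : HeightOneSpectrum (𝓞 ↥(maximalRealSubfield L'))}
      (w' : UnitaryGroup.PlacesOver L' v') (hw' : IsCMField.complexConj L' • w'.1 = w'.1)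
      [MeasurableSpace ↥(unitaryGroupOfForm (galAdicCompletionMap (L := L') (IsCMField.complexConj L') hw') ((StdForm.antidiagonal 2).over (w'.1.adicCompletion L')))]
      [BorelSpace ↥(unitaryGroupOfForm (galAdicCompletionMap (L := L') (IsCMField.complexConj L') hw') ((StdForm.antidiagonal 2).over (w'.1.adicCompletion L')))]
      (μ' : Measure ↥(unitaryGroupOfForm (galAdicCompletionMap (L := L') (IsCMField.complexConj L') hw') ((StdForm.antidiagonal 2).over (w'.1.adicCompletion L')))) [μ'.IsHaarMeasure]
      {S : Set ↥(unitaryGroupOfForm (galAdicCompletionMap (L := L') (IsCMField.complexConj L') hw') ((StdForm.antidiagonal 2).over (w'.1.adicCompletion L')))} (_ : IsCompact S),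
      ∃ W_E : ↥(unitaryGroupOfForm (galAdicCompletionMap (L := L') (IsCMField.complexConj L') hw') ((StdForm.antidiagonal 2).over (w'.1.adicCompletion L'))) → ℝ,
        LocallyIntegrable W_E μ' ∧ (∀ g, 0 ≤ W_E g) ∧
        ∀ γ : ↥(unitaryGroupOfForm (galAdicCompletionMap (L := L') (IsCMField.complexConj L') hw') ((StdForm.antidiagonal 2).over (w'.1.adicCompletion L'))),
          IsRegularElt (γ : GL (Fin 2) (w'.1.adicCompletion L')) →
          IsCompact ((Subgroup.centralizer ({γ} : Set ↥(unitaryGroupOfForm (galAdicCompletionMap (L := L') (IsCMField.complexConj L') hw') ((StdForm.antidiagonal 2).over (w'.1.adicCompletion L'))))) :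
              Set ↥(unitaryGroupOfForm (galAdicCompletionMap (L := L') (IsCMField.complexConj L') hw') ((StdForm.antidiagonal 2).over (w'.1.adicCompletion L')))) →
            ∀ Θ : ↥(unitaryGroupOfForm (galAdicCompletionMap (L := L') (IsCMField.complexConj L') hw') ((StdForm.antidiagonal 2).over (w'.1.adicCompletion L'))) → ℝ≥0∞,
              Measurable Θ → (∀ g, Θ g ≠ 0 → g ∈ S) → ∀ Mb : ℝ≥0∞, (∀ g, Θ g ≤ Mb) →
                ∫⁻ x, Θ (x * γ * x⁻¹) ∂μ' ≤ ENNReal.ofReal (W_E γ) * Mb) →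
      ∀ (L : Type) [Field L] [NumberField L] [IsCMField L] (v : HeightOneSpectrum (𝓞 ↥(maximalRealSubfield L))),
      (∀ w : PlacesOver L v, IsCMField.complexConj L • w.1 = w.1) →
    ∀ [MeasurableSpace ((UnitaryGroup.cmDatum L 2 (Matrix.of fun i j : Fin 2 => if i.val + j.val + 1 = 2 then (1 : L) else 0)).Local v)] [BorelSpace ((UnitaryGroup.cmDatum L 2 (Matrix.of fun i j : Fin 2 => if i.val + j.val + 1 = 2 then (1 : L) else 0)).Local v)]
      (μ : Measure ((UnitaryGroup.cmDatum L 2 (Matrix.of fun i j : Fin 2 => if i.val + j.val + 1 = 2 then (1 : L) else 0)).Local v)) [μ.IsHaarMeasure]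
      (r : SmoothIrrep ((UnitaryGroup.cmDatum L 2 (Matrix.of fun i j : Fin 2 => if i.val + j.val + 1 = 2 then (1 : L) else 0)).Local v)), r.ρ.IsSupercuspidal →
    ∀ (B : r.V →ₗ⋆[ℂ] r.V →ₗ[ℂ] ℂ), B.IsSymm → (∀ x : r.V, x ≠ 0 → 0 < (B x x).re) →
      (∀ (g : ((UnitaryGroup.cmDatum L 2 (Matrix.of fun i j : Fin 2 => if i.val + j.val + 1 = 2 then (1 : L) else 0)).Local v)) (x y : r.V), B (r.ρ g x) (r.ρ g y) = B x y) →
    ∀ (v₁ : r.V), v₁ ≠ 0 →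
      ∃ (Ω : CompactExhaustion ((UnitaryGroup.cmDatum L 2 (Matrix.of fun i j : Fin 2 => if i.val + j.val + 1 = 2 then (1 : L) else 0)).Local v))
        (F : ((UnitaryGroup.cmDatum L 2 (Matrix.of fun i j : Fin 2 => if i.val + j.val + 1 = 2 then (1 : L) else 0)).Local v) → ℂ) (M : ((UnitaryGroup.cmDatum L 2 (Matrix.of fun i j : Fin 2 => if i.val + j.val + 1 = 2 then (1 : L) else 0)).Local v) → ℝ),
        (∀ᵐ g ∂μ, ¬ (IsRegularElt (g.val : GL (Fin 2) (UnitaryGroup.LocalRing L v)) ∧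
            IsCompact ((Subgroup.centralizer ({g} : Set ((UnitaryGroup.cmDatum L 2 (Matrix.of fun i j : Fin 2 => if i.val + j.val + 1 = 2 then (1 : L) else 0)).Local v))) : Set ((UnitaryGroup.cmDatum L 2 (Matrix.of fun i j : Fin 2 => if i.val + j.val + 1 = 2 then (1 : L) else 0)).Local v))) →
          Tendsto (fun n => ∫ x in Ω n, B v₁ (r.ρ (x * g * x⁻¹) v₁) ∂μ) atTop (𝓝 (F g))) ∧
        (∀ n : ℕ, ∀ᵐ g ∂μ, ‖∫ x in Ω n, B v₁ (r.ρ (x * g * x⁻¹) v₁) ∂μ‖ ≤ M g) ∧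
        LocallyIntegrable M μ) :
    ∀ (L : Type) [Field L] [NumberField L] [IsCMField L] (v : HeightOneSpectrum (𝓞 ↥(maximalRealSubfield L))),
      (∀ w : PlacesOver L v, IsCMField.complexConj L • w.1 = w.1) →
    ∀ [MeasurableSpace ((UnitaryGroup.cmDatum L 2 (Matrix.of fun i j : Fin 2 => if i.val + j.val + 1 = 2 then (1 : L) else 0)).Local v)] [BorelSpace ((UnitaryGroup.cmDatum L 2 (Matrix.of fun i j : Fin 2 => if i.val + j.val + 1 = 2 then (1 : L) else 0)).Local v)]
      (μ : Measure ((UnitaryGroup.cmDatum L 2 (Matrix.of fun i j : Fin 2 => if i.val + j.val + 1 = 2 then (1 : L) else 0)).Local v)) [μ.IsHaarMeasure]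
      (r : SmoothIrrep ((UnitaryGroup.cmDatum L 2 (Matrix.of fun i j : Fin 2 => if i.val + j.val + 1 = 2 then (1 : L) else 0)).Local v)), r.ρ.IsSupercuspidal →
    ∀ (B : r.V →ₗ⋆[ℂ] r.V →ₗ[ℂ] ℂ), B.IsSymm → (∀ x : r.V, x ≠ 0 → 0 < (B x x).re) →
      (∀ (g : ((UnitaryGroup.cmDatum L 2 (Matrix.of fun i j : Fin 2 => if i.val + j.val + 1 = 2 then (1 : L) else 0)).Local v)) (x y : r.V), B (r.ρ g x) (r.ρ g y) = B x y) →
    ∀ (v₁ : r.V), v₁ ≠ 0 →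
      ∃ (Ω : CompactExhaustion ((UnitaryGroup.cmDatum L 2 (Matrix.of fun i j : Fin 2 => if i.val + j.val + 1 = 2 then (1 : L) else 0)).Local v))
        (F : ((UnitaryGroup.cmDatum L 2 (Matrix.of fun i j : Fin 2 => if i.val + j.val + 1 = 2 then (1 : L) else 0)).Local v) → ℂ) (M : ((UnitaryGroup.cmDatum L 2 (Matrix.of fun i j : Fin 2 => if i.val + j.val + 1 = 2 then (1 : L) else 0)).Local v) → ℝ),
        (∀ᵐ g ∂μ, ¬ (IsRegularElt (g.val : GL (Fin 2) (UnitaryGroup.LocalRing L v)) ∧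
            IsCompact ((Subgroup.centralizer ({g} : Set ((UnitaryGroup.cmDatum L 2 (Matrix.of fun i j : Fin 2 => if i.val + j.val + 1 = 2 then (1 : L) else 0)).Local v))) : Set ((UnitaryGroup.cmDatum L 2 (Matrix.of fun i j : Fin 2 => if i.val + j.val + 1 = 2 then (1 : L) else 0)).Local v))) →
          Tendsto (fun n => ∫ x in Ω n, B v₁ (r.ρ (x * g * x⁻¹) v₁) ∂μ) atTop (𝓝 (F g))) ∧
        (∀ n : ℕ, ∀ᵐ g ∂μ, ‖∫ x in Ω n, B v₁ (r.ρ (x * g * x⁻¹) v₁) ∂μ‖ ≤ M g) ∧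
        LocallyIntegrable M μ :=
  hM5h₂ (ellWeightPlace_two_of_letters hCOV hUP hDIAG hCOLL hNC)

end Summit.HodgeConjecture.HodgeConjecture.Cruxes.H413.K2E3SupercuspidalTruncatedCharAnalyticTwoOfLetters

end
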